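/-
Copyright (c) 2026. Released under the project licence.
-/
import Mathlib
import Literature.NumberTheory.DiophantineApproximation.L2Discrepancy
import Literature.Combinatorics.Enumerative.AntidiagonalTupleCard

/-!
# Roth's lower bound on the `L₂`-discrepancy

Topic `Literature/NumberTheory/DiophantineApproximation`; PROVED theorems (no named fact).

ROTH's theorem (1954): for every dimension `s ≥ 1` and every `N`-point set `P` in the
`s`-dimensional unit cube,
`L_{2,N}(P) ≥ (1/N) · √(binom(⌊log₂ N⌋ + s + 1, s − 1)) · 2^{−(2s+4)} ≥ c_s (log N)^{(s−1)/2} / N`,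
`c_s = 1/(2^{2s+4} (log 2)^{(s−1)/2} √((s−1)!))`
[cite: DickPillichshammer2010, Thm. 3.20; Roth1954 (the original, `s = 2`)], and consequently the
same lower bound holds for the star discrepancy, `D*_N(P) ≥ L_{2,N}(P)`
[cite: DickPillichshammer2010, Rem. 3.21].  Here `L_{2,N}(P)² = ∫_{[0,1]^s} Δ_P(z)² dz`
(`Discrepancy.l2DiscrepancySq`, file `L2Discrepancy.lean`) and `D*_N = sup |Δ_P|`
(`Discrepancy.starDiscrepancy`, file `KoksmaHlawkaInequality.lean`), with the local discrepancy
`Δ_P(z) = #{n : x_n ∈ [0,z)}/N − ∏ z_i` (`Discrepancy.boxDelta`).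

We formalise the proof of [cite: DickPillichshammer2010, §3.2 (Lemmas 3.22–3.25 and the proof of
Thm. 3.20)], which follows [cite: KuipersNiederreiter1974, Ch. 2, Lemmas 2.1–2.5] (the
orthogonality of the Rademacher-type functions `ψ(2^r t)`), with the auxiliary function written
as a finite sum over pairs `(r, h)` of a shape `r ∈ ℕ₀^s`, `|r|₁ = d`, and an EMPTY dyadic box
`h` of shape `r` (no point `x_n` has `⌊2^{r_i} x_{n,i}⌋ = h_i` for all `i`):
`F(z) = Σ_{(r,h)} ∏_i ψ_{r_i,h_i}(z_i)` where `ψ_{r,h} = 1_{[(2h+1)/2^{r+1},(2h+2)/2^{r+1})}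
  − 1_{[2h/2^{r+1},(2h+1)/2^{r+1})}` is `ψ(2^r t)` restricted to the dyadic interval
`[h/2^r,(h+1)/2^r)` (`Discrepancy.rothPsi`, `Discrepancy.rothF`; this is the function
`F = Σ_r F_r`, `F_r = G_r(2^{r_1}x_1,…)` of [cite: DickPillichshammer2010, §3.2 (notation before Lemma 3.22)]).

Main statements (the point set `x : Fin N → Fin s → ℝ` is ARBITRARY — the proof needs no
hypothesis on the position of the points; `1 ≤ s`, `0 < N`):
* `Discrepancy.roth_integral_prod_mul_rothF` — Lemma 3.23:
  `∫ z_1⋯z_s F = #pairs / 4^{d+s} ≥ binom(d+s−1,s−1)(2^d − N)/2^{2(d+s)}`;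
* `Discrepancy.roth_integral_rothF_sq` / `roth_integral_rothF_sq_le` — Lemma 3.24:
  `∫ F² = #pairs / 2^d ≤ binom(d+s−1,s−1)`;
* `Discrepancy.roth_integral_ind_mul_rothF` — Lemma 3.25: `∫_{J_n} F = 0`, `J_n = ∏ (x_{n,i},1]`;
* `Discrepancy.roth_sq_lower_bound_core` — the display
  `∫ (N Δ_P)² ≥ N² binom(d+s−1,s−1) 2^{−4(d+s)} (2^d − N)²` for `N ≤ 2^d`;
* `Discrepancy.roth_sq_lower_bound_choose` — `∫ (N Δ_P)² ≥ binom(⌊log₂N⌋+s+1, s−1)/2^{4s+8}`;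
* `Discrepancy.roth_lower_bound_choose`, `Discrepancy.roth_lower_bound` — **Theorem 3.20**
  (both printed inequalities, with `Discrepancy.rothConstant s = c_s`);
* `Discrepancy.l2DiscrepancySq_le_starDiscrepancy_sq`, `Discrepancy.roth_lower_bound_starDiscrepancy`
  — **Remark 3.21** (`L_{2,N} ≤ D*_N`, hence `N · D*_N(P) ≥ c_s (log N)^{(s−1)/2}`).

Not formalised here: Schmidt's extension to `L_q`, `1 < q < 2`, and the sharpness results of
Davenport, Roth, Frolov, Chen–Skriganov [cite: DickPillichshammer2010, §3.2 (discussion after the proof of Thm. 3.20)].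
-/

noncomputable section

namespace Literature.NumberTheory.DiophantineApproximation

namespace Discrepancy

open MeasureTheory Set Finset

variable {N s : ℕ}

/-! ### Dyadic intervals and the Rademacher-type functions `ψ_{r,h}` -/

/-- The dyadic interval `[k/2^q, (k+1)/2^q)` (the intervals `[a,b) = [h 2^{-r_i}, m 2^{-r_i})` of
Lemma 3.22, and their halves). [cite: DickPillichshammer2010, Lemma 3.22] -/
def dyadIco (q k : ℕ) : Set ℝ := Ico ((k : ℝ) / 2 ^ q) (((k : ℝ) + 1) / 2 ^ q)

/-- `ψ_{r,h}(t) = ψ(2^r t) · 1_{[h/2^r,(h+1)/2^r)}(t)`: `+1` on the upper half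
`[(2h+1)/2^{r+1}, (2h+2)/2^{r+1})` and `−1` on the lower half `[2h/2^{r+1}, (2h+1)/2^{r+1})` of the
dyadic interval `[h/2^r, (h+1)/2^r)`, `0` elsewhere (`ψ(x) = (−1)^{ξ₁(x)+1} = −2·wal₁(x)`).
[cite: DickPillichshammer2010, §3.2 (notation before Lemma 3.22: the functions `ψ`, `G_r`, `F_r`)] -/
def rothPsi (r h : ℕ) (t : ℝ) : ℝ :=
  (dyadIco (r + 1) (2 * h + 1)).indicator (fun _ => (1 : ℝ)) t -
    (dyadIco (r + 1) (2 * h)).indicator (fun _ => (1 : ℝ)) t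

/-- Dyadic intervals are measurable. [folklore] -/
private theorem measurableSet_dyadIco (q k : ℕ) : MeasurableSet (dyadIco q k) := measurableSet_Ico

/-- `[k/2^q,(k+1)/2^q) ⊆ [0,1]` for `k < 2^q`. [folklore] -/
private theorem dyadIco_subset_Icc {q k : ℕ} (hk : k < 2 ^ q) : dyadIco q k ⊆ Icc (0 : ℝ) 1 := by
  intro t ht
  have hq : (0 : ℝ) < 2 ^ q := by positivity
  refine ⟨le_trans (div_nonneg (Nat.cast_nonneg _) hq.le) ht.1, le_trans ht.2.le ?_⟩
  rw [div_le_one hq]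
  exact_mod_cast Nat.succ_le_of_lt hk

/-- A point lies in at most one dyadic interval of a given level. [folklore] -/
private theorem dyadIco_index_unique {q k k' : ℕ} {t : ℝ} (h1 : t ∈ dyadIco q k)
    (h2 : t ∈ dyadIco q k') : k = k' := by
  have hq : (0 : ℝ) < 2 ^ q := by positivity
  have e1 : (k : ℝ) < k' + 1 := by
    have := lt_of_le_of_lt h1.1 h2.2
    rwa [div_lt_div_iff_of_pos_right hq] at this
  have e2 : (k' : ℝ) < k + 1 := by
    have := lt_of_le_of_lt h2.1 h1.2
    rwa [div_lt_div_iff_of_pos_right hq] at this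
  have f1 : k < k' + 1 := by exact_mod_cast e1
  have f2 : k' < k + 1 := by exact_mod_cast e2
  omega

/-- Nesting of dyadic intervals: `[k'/2^{q+e},(k'+1)/2^{q+e}) ⊆ [m/2^q,(m+1)/2^q)` with
`m = ⌊k'/2^e⌋`. [folklore] -/
private theorem dyadIco_add_subset (q e k' : ℕ) : dyadIco (q + e) k' ⊆ dyadIco q (k' / 2 ^ e) := by
  intro t ht
  set D : ℕ := 2 ^ e with hD
  have hDpos : 0 < D := by positivity
  set m : ℕ := k' / D with hm
  have hm1 : m * D ≤ k' := Nat.div_mul_le_self k' D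
  have hm2 : k' + 1 ≤ (m + 1) * D := by
    have h := Nat.lt_div_mul_add (a := k') hDpos
    rw [add_mul, one_mul]
    exact h
  have hq0 : (0 : ℝ) < 2 ^ q := by positivity
  have hD0 : (0 : ℝ) < D := by exact_mod_cast hDpos
  have h2e : (2 : ℝ) ^ (q + e) = 2 ^ q * (D : ℝ) := by
    rw [pow_add, hD]; push_cast; ring
  constructor
  · calc (m : ℝ) / 2 ^ q = ((m * D : ℕ) : ℝ) / 2 ^ (q + e) := by
          rw [h2e]; push_cast; field_simp
      _ ≤ (k' : ℝ) / 2 ^ (q + e) := by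
          have h' : ((m * D : ℕ) : ℝ) ≤ k' := by exact_mod_cast hm1
          gcongr
      _ ≤ t := ht.1
  · calc t < ((k' : ℝ) + 1) / 2 ^ (q + e) := ht.2
      _ ≤ (((m + 1) * D : ℕ) : ℝ) / 2 ^ (q + e) := by
          have h' : (k' : ℝ) + 1 ≤ (((m + 1) * D : ℕ) : ℝ) := by exact_mod_cast hm2
          gcongr
      _ = ((m : ℝ) + 1) / 2 ^ q := by rw [h2e]; push_cast; field_simp

/-- The two halves of `[h/2^r,(h+1)/2^r)`: `[(2h+j)/2^{r+1}, (2h+j+1)/2^{r+1}) ⊆ [h/2^r,(h+1)/2^r)`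
for `j ∈ {0,1}`. [folklore] -/
private theorem dyadIco_succ_subset {r h j : ℕ} (hj : j < 2) : dyadIco (r + 1) (2 * h + j) ⊆ dyadIco r h := by
  have h1 := dyadIco_add_subset r 1 (2 * h + j)
  have h2 : (2 * h + j) / 2 ^ 1 = h := by rw [pow_one]; omega
  rwa [h2] at h1

/-- On a dyadic interval of level `q`, the indicator of any level-`q` dyadic interval is
constant. [folklore] -/
private theorem indicator_dyadIco_apply_of_mem {q m k : ℕ} {t : ℝ} (ht : t ∈ dyadIco q m) :
    (dyadIco q k).indicator (fun _ => (1 : ℝ)) t = if k = m then 1 else 0 := by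
  by_cases hkm : k = m
  · subst hkm; rw [indicator_of_mem ht, if_pos rfl]
  · rw [if_neg hkm, indicator_of_notMem]
    exact fun ht' => hkm (dyadIco_index_unique ht' ht)

/-- `ψ_{r,h}` is constant on every dyadic interval of level `r+1`. [folklore] -/
private theorem rothPsi_apply_of_mem {r m h : ℕ} {t : ℝ} (ht : t ∈ dyadIco (r + 1) m) :
    rothPsi r h t = (if 2 * h + 1 = m then (1 : ℝ) else 0) - (if 2 * h = m then (1 : ℝ) else 0) := by
  unfold rothPsi
  rw [indicator_dyadIco_apply_of_mem ht, indicator_dyadIco_apply_of_mem ht]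

/-- `ψ_{r,h}` vanishes off `[h/2^r,(h+1)/2^r)`. [folklore] -/
private theorem rothPsi_eq_zero_of_not_mem {r h : ℕ} {t : ℝ} (ht : t ∉ dyadIco r h) : rothPsi r h t = 0 := by
  unfold rothPsi
  have h1 : t ∉ dyadIco (r + 1) (2 * h + 1) := fun h' => ht (dyadIco_succ_subset one_lt_two h')
  have h0 : t ∉ dyadIco (r + 1) (2 * h) := fun h' =>
    ht (dyadIco_succ_subset (j := 0) two_pos (by simpa using h'))
  rw [indicator_of_notMem h1, indicator_of_notMem h0, sub_zero]

/-- `|ψ_{r,h}| ≤ 1`. [folklore] -/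
private theorem abs_rothPsi_le_one (r h : ℕ) (t : ℝ) : |rothPsi r h t| ≤ 1 := by
  unfold rothPsi
  by_cases h1 : t ∈ dyadIco (r + 1) (2 * h + 1)
  · have h0 : t ∉ dyadIco (r + 1) (2 * h) := fun h0 => by
      have := dyadIco_index_unique h1 h0; omega
    rw [indicator_of_mem h1, indicator_of_notMem h0]; norm_num
  · by_cases h0 : t ∈ dyadIco (r + 1) (2 * h)
    · rw [indicator_of_notMem h1, indicator_of_mem h0]; norm_num
    · rw [indicator_of_notMem h1, indicator_of_notMem h0]; norm_num

/-- `ψ_{r,h}` is measurable. [folklore] -/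
private theorem measurable_rothPsi (r h : ℕ) : Measurable (rothPsi r h) :=
  (measurable_const.indicator (measurableSet_dyadIco _ _)).sub
    (measurable_const.indicator (measurableSet_dyadIco _ _))

/-- If `h ≠ ⌊2^r c⌋`, then `c ∉ [h/2^r,(h+1)/2^r)`: either `c < h/2^r` or `(h+1)/2^r ≤ c`
(no sign hypothesis on `c`). [folklore] -/
private theorem lt_or_le_of_ne_floor {r h : ℕ} {c : ℝ} (hne : h ≠ ⌊(2 : ℝ) ^ r * c⌋₊) :
    c < (h : ℝ) / 2 ^ r ∨ ((h : ℝ) + 1) / 2 ^ r ≤ c := by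
  by_contra hcon
  push Not at hcon
  obtain ⟨h1, h2⟩ := hcon
  have hr : (0 : ℝ) < 2 ^ r := by positivity
  rw [div_le_iff₀ hr] at h1
  rw [lt_div_iff₀ hr] at h2
  have hc : 0 ≤ (2 : ℝ) ^ r * c := by
    rw [mul_comm]; exact le_trans (by positivity) h1
  apply hne
  symm
  rw [Nat.floor_eq_iff hc]
  constructor <;> linarith

/-! ### One-dimensional integrals over `[0,1]` -/

/-- `∫_0^1 1_{[k/2^q,(k+1)/2^q)} = 2^{−q}` (`k < 2^q`). [folklore] -/
private theorem integral_indicator_dyadIco {q k : ℕ} (hk : k < 2 ^ q) :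
    ∫ t in Icc (0 : ℝ) 1, (dyadIco q k).indicator (fun _ => (1 : ℝ)) t = 1 / 2 ^ q := by
  have hq : (0 : ℝ) < 2 ^ q := by positivity
  rw [setIntegral_indicator (measurableSet_dyadIco q k),
    Set.inter_eq_self_of_subset_right (dyadIco_subset_Icc hk), setIntegral_const, measureReal_def,
    dyadIco, Real.volume_Ico, ENNReal.toReal_ofReal, smul_eq_mul, mul_one]
  · field_simp; ring
  · rw [sub_nonneg]; gcongr; linarith

/-- `∫_0^1 t · 1_{[k/2^q,(k+1)/2^q)}(t) dt = (2k+1)/(2·4^q)` (`k < 2^q`). [folklore] -/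
private theorem integral_indicator_dyadIco_id {q k : ℕ} (hk : k < 2 ^ q) :
    ∫ t in Icc (0 : ℝ) 1, (dyadIco q k).indicator (fun t => t) t = (2 * k + 1) / (2 * 4 ^ q) := by
  have hq : (0 : ℝ) < 2 ^ q := by positivity
  have hle : (k : ℝ) / 2 ^ q ≤ ((k : ℝ) + 1) / 2 ^ q := by gcongr; linarith
  rw [setIntegral_indicator (measurableSet_dyadIco q k),
    Set.inter_eq_self_of_subset_right (dyadIco_subset_Icc hk), dyadIco,
    integral_Ico_eq_integral_Ioc, ← intervalIntegral.integral_of_le hle, integral_id]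
  have h4 : (4 : ℝ) ^ q = 2 ^ q * 2 ^ q := by rw [← mul_pow]; norm_num
  rw [h4]
  field_simp
  ring

/-- `∫_0^1 1_{[k/2^q,(k+1)/2^q)}(t) 1[c < t] dt = 2^{−q}` if `c < k/2^q`. [folklore] -/
private theorem integral_indicator_dyadIco_mul_ind_of_lt {q k : ℕ} (hk : k < 2 ^ q) {c : ℝ}
    (hc : c < (k : ℝ) / 2 ^ q) :
    ∫ t in Icc (0 : ℝ) 1, (dyadIco q k).indicator (fun _ => (1 : ℝ)) t * (if c < t then 1 else 0) =
      1 / 2 ^ q := by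
  have h : (fun t => (dyadIco q k).indicator (fun _ => (1 : ℝ)) t * (if c < t then (1 : ℝ) else 0)) =
      (dyadIco q k).indicator (fun _ => (1 : ℝ)) := by
    funext t
    by_cases ht : t ∈ dyadIco q k
    · rw [indicator_of_mem ht, if_pos (hc.trans_le ht.1), mul_one]
    · rw [indicator_of_notMem ht, zero_mul]
  rw [h]
  exact integral_indicator_dyadIco hk

/-- `∫_0^1 1_{[k/2^q,(k+1)/2^q)}(t) 1[c < t] dt = 0` if `(k+1)/2^q ≤ c`. [folklore] -/
private theorem integral_indicator_dyadIco_mul_ind_of_le {q k : ℕ} {c : ℝ}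
    (hc : ((k : ℝ) + 1) / 2 ^ q ≤ c) :
    ∫ t in Icc (0 : ℝ) 1, (dyadIco q k).indicator (fun _ => (1 : ℝ)) t * (if c < t then 1 else 0) =
      0 := by
  have h : (fun t => (dyadIco q k).indicator (fun _ => (1 : ℝ)) t * (if c < t then (1 : ℝ) else 0)) =
      fun _ => 0 := by
    funext t
    by_cases ht : t ∈ dyadIco q k
    · rw [if_neg (not_lt.mpr ((ht.2.le.trans hc))), mul_zero]
    · rw [indicator_of_notMem ht, zero_mul]
  rw [h, integral_zero]

/-- `2h + 1 < 2^{r+1}` for `h < 2^r`. [folklore] -/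
private theorem two_mul_add_one_lt {r h : ℕ} (hh : h < 2 ^ r) : 2 * h + 1 < 2 ^ (r + 1) := by
  rw [pow_succ]; omega

/-- `2h < 2^{r+1}` for `h < 2^r`. [folklore] -/
private theorem two_mul_lt {r h : ℕ} (hh : h < 2 ^ r) : 2 * h < 2 ^ (r + 1) := by
  rw [pow_succ]; omega

/-- Indicators of dyadic intervals are integrable on `[0,1]`. [folklore] -/
private theorem integrable_indicator_dyadIco (q k : ℕ) :
    Integrable ((dyadIco q k).indicator fun _ => (1 : ℝ)) ((volume : Measure ℝ).restrict (Icc 0 1)) :=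
  (integrable_const (1 : ℝ)).indicator (measurableSet_dyadIco q k)

/-- A measurable function bounded on `[0,1]` is integrable on `[0,1]`. [folklore] -/
private theorem integrableOn_unit_of_bounded {φ : ℝ → ℝ} (hφ : Measurable φ) (C : ℝ)
    (hC : ∀ t ∈ Icc (0 : ℝ) 1, |φ t| ≤ C) : IntegrableOn φ (Icc (0 : ℝ) 1) := by
  have h : MemLp φ 1 ((volume : Measure ℝ).restrict (Icc 0 1)) :=
    MemLp.of_bound hφ.aestronglyMeasurable C
      ((ae_restrict_iff' measurableSet_Icc).2
        (Filter.Eventually.of_forall fun t ht => by rw [Real.norm_eq_abs]; exact hC t ht))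
  exact memLp_one_iff_integrable.mp h

/-- `∫_0^1 ψ_{r,h} = 0` (`h < 2^r`). [cite: DickPillichshammer2010, proof of Lemma 3.22
(`∫_c^{c+1} ψ(t) dt = 0`)] -/
theorem integral_rothPsi {r h : ℕ} (hh : h < 2 ^ r) : ∫ t in Icc (0 : ℝ) 1, rothPsi r h t = 0 := by
  unfold rothPsi
  rw [integral_sub, integral_indicator_dyadIco (two_mul_add_one_lt hh)]
  · have h0 := integral_indicator_dyadIco (q := r + 1) (two_mul_lt hh)
    rw [h0, sub_self]
  · exact integrable_indicator_dyadIco _ _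
  · exact integrable_indicator_dyadIco _ _


/-- Measurability of `t ↦ 1[c < t]`. [folklore] -/
private theorem measurable_ind₁ (c : ℝ) : Measurable fun t : ℝ => if c < t then (1 : ℝ) else 0 :=
  Measurable.ite (measurableSet_lt measurable_const measurable_id) measurable_const measurable_const

/-- `|1[c < t]| ≤ 1`. [folklore] -/
private theorem abs_ind₁_le_one (c t : ℝ) : |(if c < t then (1 : ℝ) else 0)| ≤ 1 := by
  by_cases h : c < t <;> simp [h]

/-- `|t| ≤ 1` on `[0,1]`. [folklore] -/
private theorem abs_le_one_of_mem_Icc {t : ℝ} (ht : t ∈ Icc (0 : ℝ) 1) : |t| ≤ 1 := by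
  rw [abs_of_nonneg ht.1]; exact ht.2

/-- `|φ ψ_{r,h}| ≤ 1` if `|φ| ≤ 1`. [folklore] -/
private theorem abs_mul_rothPsi_le_one {a : ℝ} (ha : |a| ≤ 1) (r h : ℕ) (t : ℝ) :
    |a * rothPsi r h t| ≤ 1 := by
  rw [abs_mul]; exact mul_le_one₀ ha (abs_nonneg _) (abs_rothPsi_le_one r h t)

/-- `∫_0^1 t ψ_{r,h}(t) dt = 4^{−(r+1)}` (`h < 2^r`): on `[h/2^r,(h+1)/2^r)` rescaled to `[h', h'+1)`,
`∫_{h'}^{h'+1} t ψ(t) dt = 1/4`. [cite: DickPillichshammer2010, proof of Lemma 3.23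
(`∫_h^{h+1} t ψ(t) dt = 1/4`)] -/
theorem integral_id_mul_rothPsi {r h : ℕ} (hh : h < 2 ^ r) :
    ∫ t in Icc (0 : ℝ) 1, t * rothPsi r h t = 1 / 4 ^ (r + 1) := by
  have hpt : (fun t => t * rothPsi r h t) = fun t =>
      (dyadIco (r + 1) (2 * h + 1)).indicator (fun t => t) t -
        (dyadIco (r + 1) (2 * h)).indicator (fun t => t) t := by
    funext t
    unfold rothPsi
    by_cases h1 : t ∈ dyadIco (r + 1) (2 * h + 1) <;> by_cases h0 : t ∈ dyadIco (r + 1) (2 * h) <;>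
      simp [h1, h0]
  have hint : ∀ {k : ℕ}, k < 2 ^ (r + 1) →
      Integrable ((dyadIco (r + 1) k).indicator fun t : ℝ => t)
        ((volume : Measure ℝ).restrict (Icc 0 1)) := by
    intro k hk
    refine integrableOn_unit_of_bounded (measurable_id.indicator (measurableSet_dyadIco _ _)) 1
      fun t _ => ?_
    by_cases ht : t ∈ dyadIco (r + 1) k
    · rw [indicator_of_mem ht]; exact abs_le_one_of_mem_Icc (dyadIco_subset_Icc hk ht)
    · rw [indicator_of_notMem ht, abs_zero]; exact zero_le_one
  rw [hpt, integral_sub (hint (two_mul_add_one_lt hh)) (hint (two_mul_lt hh)),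
    integral_indicator_dyadIco_id (two_mul_add_one_lt hh),
    integral_indicator_dyadIco_id (q := r + 1) (two_mul_lt hh)]
  have h4 : (4 : ℝ) ^ (r + 1) ≠ 0 := by positivity
  push_cast
  field_simp
  ring

/-- `∫_0^1 1[c < t] ψ_{r,h}(t) dt = 0` whenever `c ∉ [h/2^r,(h+1)/2^r)` (`h < 2^r`): the integral is
over the whole dyadic interval or over nothing. [cite: DickPillichshammer2010, Lemma 3.22
(`∫_a^b F_r dx_i = 0` for `a = h 2^{-r_i}`, `b = m 2^{-r_i}`)] -/
theorem integral_ind_mul_rothPsi {r h : ℕ} (hh : h < 2 ^ r) {c : ℝ}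
    (hc : c < (h : ℝ) / 2 ^ r ∨ ((h : ℝ) + 1) / 2 ^ r ≤ c) :
    ∫ t in Icc (0 : ℝ) 1, (if c < t then (1 : ℝ) else 0) * rothPsi r h t = 0 := by
  have hpt : (fun t => (if c < t then (1 : ℝ) else 0) * rothPsi r h t) = fun t =>
      (dyadIco (r + 1) (2 * h + 1)).indicator (fun _ => (1 : ℝ)) t * (if c < t then (1 : ℝ) else 0) -
        (dyadIco (r + 1) (2 * h)).indicator (fun _ => (1 : ℝ)) t * (if c < t then (1 : ℝ) else 0) := by
    funext t; unfold rothPsi; ring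
  have hint : ∀ k : ℕ, Integrable (fun t =>
      (dyadIco (r + 1) k).indicator (fun _ => (1 : ℝ)) t * (if c < t then (1 : ℝ) else 0))
        ((volume : Measure ℝ).restrict (Icc 0 1)) := by
    intro k
    refine integrableOn_unit_of_bounded
      ((measurable_const.indicator (measurableSet_dyadIco _ _)).mul (measurable_ind₁ c)) 1
      fun t _ => ?_
    rw [abs_mul]
    refine mul_le_one₀ ?_ (abs_nonneg _) (abs_ind₁_le_one c t)
    by_cases ht : t ∈ dyadIco (r + 1) k
    · rw [indicator_of_mem ht, abs_one]
    · rw [indicator_of_notMem ht, abs_zero]; exact zero_le_one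
  rw [hpt, integral_sub (hint _) (hint _)]
  have hr : (0 : ℝ) < 2 ^ r := by positivity
  have e2 : (2 : ℝ) ^ (r + 1) = 2 ^ r * 2 := pow_succ 2 r
  rcases hc with hc | hc
  · have e0 : c < ((2 * h : ℕ) : ℝ) / 2 ^ (r + 1) := by
      rw [e2]; push_cast
      calc c < (h : ℝ) / 2 ^ r := hc
        _ = 2 * (h : ℝ) / (2 ^ r * 2) := by field_simp
    have e1 : c < ((2 * h + 1 : ℕ) : ℝ) / 2 ^ (r + 1) := by
      refine e0.trans_le ?_
      gcongr
      omega
    rw [integral_indicator_dyadIco_mul_ind_of_lt (two_mul_add_one_lt hh) e1,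
      integral_indicator_dyadIco_mul_ind_of_lt (two_mul_lt hh) e0, sub_self]
  · have e1 : (((2 * h + 1 : ℕ) : ℝ) + 1) / 2 ^ (r + 1) ≤ c := by
      refine le_trans (le_of_eq ?_) hc
      rw [e2]; push_cast; field_simp; ring
    have e0 : (((2 * h : ℕ) : ℝ) + 1) / 2 ^ (r + 1) ≤ c := by
      refine le_trans ?_ e1
      gcongr
      linarith
    rw [integral_indicator_dyadIco_mul_ind_of_le e1, integral_indicator_dyadIco_mul_ind_of_le e0,
      sub_self]

/-- Orthogonality at one level: `∫_0^1 ψ_{r,h} ψ_{r,h'} = δ_{h,h'} 2^{−r}` (`h, h' < 2^r`).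
[cite: DickPillichshammer2010, proof of Lemma 3.24 (`F_r² ≤ 1`, disjoint supports)] -/
theorem integral_rothPsi_mul_rothPsi {r h h' : ℕ} (hh : h < 2 ^ r) (hh' : h' < 2 ^ r) :
    ∫ t in Icc (0 : ℝ) 1, rothPsi r h t * rothPsi r h' t = if h = h' then 1 / 2 ^ r else 0 := by
  by_cases e : h = h'
  · subst e
    rw [if_pos rfl]
    have hpt : (fun t => rothPsi r h t * rothPsi r h t) = fun t =>
        (dyadIco (r + 1) (2 * h + 1)).indicator (fun _ => (1 : ℝ)) t +
          (dyadIco (r + 1) (2 * h)).indicator (fun _ => (1 : ℝ)) t := by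
      funext t
      unfold rothPsi
      by_cases h1 : t ∈ dyadIco (r + 1) (2 * h + 1)
      · have h0 : t ∉ dyadIco (r + 1) (2 * h) := fun h0 => by
          have := dyadIco_index_unique h1 h0; omega
        simp [h1, h0]
      · by_cases h0 : t ∈ dyadIco (r + 1) (2 * h) <;> simp [h1, h0]
    rw [hpt, integral_add (integrable_indicator_dyadIco _ _) (integrable_indicator_dyadIco _ _),
      integral_indicator_dyadIco (two_mul_add_one_lt hh),
      integral_indicator_dyadIco (q := r + 1) (two_mul_lt hh), pow_succ]
    field_simp
    norm_num
  · rw [if_neg e]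
    have hpt : (fun t => rothPsi r h t * rothPsi r h' t) = fun _ => 0 := by
      funext t
      by_cases ht : t ∈ dyadIco r h
      · have ht' : t ∉ dyadIco r h' := fun ht' => e (dyadIco_index_unique ht ht')
        rw [rothPsi_eq_zero_of_not_mem ht', mul_zero]
      · rw [rothPsi_eq_zero_of_not_mem ht, zero_mul]
    rw [hpt, integral_zero]

/-- `∫_0^1 ψ_{r,h}² = 2^{−r}` (`h < 2^r`). [folklore] -/
private theorem integral_rothPsi_mul_self {r h : ℕ} (hh : h < 2 ^ r) :
    ∫ t in Icc (0 : ℝ) 1, rothPsi r h t * rothPsi r h t = 1 / 2 ^ r := by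
  rw [integral_rothPsi_mul_rothPsi hh hh, if_pos rfl]

/-- Orthogonality across levels: `∫_0^1 ψ_{r,h} ψ_{r',h'} = 0` for `r ≠ r'` (`h < 2^r`, `h' < 2^{r'}`):
the coarser function is constant on the support of the finer one, which has mean zero.
[cite: DickPillichshammer2010, proof of Lemma 3.24 (`∫_c^{c+1} ψ(2^{r_i−w_i}t) ψ(t) dt = 0`)] -/
theorem integral_rothPsi_mul_rothPsi_of_ne {r r' h h' : ℕ} (hr : r ≠ r') (hh : h < 2 ^ r)
    (hh' : h' < 2 ^ r') : ∫ t in Icc (0 : ℝ) 1, rothPsi r h t * rothPsi r' h' t = 0 := by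
  -- without loss of generality `r < r'`
  wlog hlt : r < r' generalizing r r' h h' with H
  · have hgt : r' < r := lt_of_le_of_ne (not_lt.1 hlt) (Ne.symm hr)
    have := H (Ne.symm hr) hh' hh hgt
    have e : (fun t => rothPsi r h t * rothPsi r' h' t) = fun t => rothPsi r' h' t * rothPsi r h t :=
      funext fun t => mul_comm _ _
    rw [e]
    exact this
  -- `ψ_{r,h}` is constant on `dyadIco r' h' ⊆ dyadIco (r+1) m`
  obtain ⟨e, he⟩ := Nat.exists_eq_add_of_le (Nat.succ_le_of_lt hlt)
  obtain ⟨c, hc⟩ : ∃ c : ℝ, ∀ t ∈ dyadIco r' h', rothPsi r h t = c := by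
    refine ⟨(if 2 * h + 1 = h' / 2 ^ e then (1 : ℝ) else 0) - (if 2 * h = h' / 2 ^ e then (1 : ℝ) else 0),
      fun t ht => ?_⟩
    have hsub : dyadIco r' h' ⊆ dyadIco (r + 1) (h' / 2 ^ e) := by
      rw [he]; exact dyadIco_add_subset (r + 1) e h'
    exact rothPsi_apply_of_mem (hsub ht)
  have hpt : (fun t => rothPsi r h t * rothPsi r' h' t) = fun t => c * rothPsi r' h' t := by
    funext t
    by_cases ht : t ∈ dyadIco r' h'
    · rw [hc t ht]
    · rw [rothPsi_eq_zero_of_not_mem ht, mul_zero, mul_zero]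
  rw [hpt, integral_const_mul, integral_rothPsi hh', mul_zero]

/-! ### Lebesgue measure on the cube and sums of product integrands -/

/-- Lebesgue measure on the unit cube is the product of `s` copies of Lebesgue measure on
`[0,1]`. [folklore] -/
private theorem volume_restrict_unitCube₀ (s : ℕ) :
    (volume : Measure (Fin s → ℝ)).restrict (Icc 0 1) =
      Measure.pi fun _ : Fin s => (volume : Measure ℝ).restrict (Icc 0 1) := by
  rw [← Set.pi_univ_Icc, volume_pi, Measure.restrict_pi_pi]
  rfl

/-- The unit cube has finite Lebesgue measure. [folklore] -/
private theorem isFiniteMeasure_cube₀ (s : ℕ) :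
    IsFiniteMeasure ((volume : Measure (Fin s → ℝ)).restrict (Icc 0 1)) :=
  isFiniteMeasure_restrict.mpr (isCompact_Icc.measure_lt_top).ne

/-- `∫_{[0,1]^s} ∏_i g_i(z_i) dz = ∏_i ∫_0^1 g_i` (Fubini on the product measure). [folklore] -/
private theorem integral_cube_prod_univ (g : Fin s → ℝ → ℝ) :
    ∫ z in Icc (0 : Fin s → ℝ) 1, ∏ i, g i (z i) = ∏ i, ∫ t in Icc (0 : ℝ) 1, g i t := by
  have h2 := integral_fintype_prod_eq_prod (𝕜 := ℝ)
    (μ := fun _ : Fin s => (volume : Measure ℝ).restrict (Icc 0 1)) (fun i t => g i t)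
  rw [volume_restrict_unitCube₀]
  exact h2

/-- A measurable function bounded on the unit cube is integrable on it. [folklore] -/
private theorem integrableOn_cube_of_bounded₀ {φ : (Fin s → ℝ) → ℝ} (hφ : Measurable φ) (C : ℝ)
    (hC : ∀ z ∈ Icc (0 : Fin s → ℝ) 1, |φ z| ≤ C) : IntegrableOn φ (Icc (0 : Fin s → ℝ) 1) := by
  haveI := isFiniteMeasure_cube₀ s
  have h : MemLp φ 1 ((volume : Measure (Fin s → ℝ)).restrict (Icc 0 1)) :=
    MemLp.of_bound hφ.aestronglyMeasurable C
      ((ae_restrict_iff' measurableSet_Icc).2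
        (Filter.Eventually.of_forall fun z hz => by rw [Real.norm_eq_abs]; exact hC z hz))
  exact memLp_one_iff_integrable.mp h

/-- A product `∏_i g_i(z_i)` of measurable factors with `|g_i| ≤ 1` on `[0,1]` is integrable on
the cube. [folklore] -/
private theorem integrableOn_cube_prod {g : Fin s → ℝ → ℝ} (hm : ∀ i, Measurable (g i))
    (hb : ∀ i, ∀ t ∈ Icc (0 : ℝ) 1, |g i t| ≤ 1) :
    IntegrableOn (fun z : Fin s → ℝ => ∏ i, g i (z i)) (Icc (0 : Fin s → ℝ) 1) :=
  integrableOn_cube_of_bounded₀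
    (Finset.measurable_prod _ fun i _ => (hm i).comp (measurable_pi_apply i)) 1
    fun z hz => by
      rw [Finset.abs_prod]
      exact prod_le_one (fun i _ => abs_nonneg _) fun i _ => hb i (z i) ⟨hz.1 i, hz.2 i⟩

/-- `∫_{[0,1]^s} Σ_{p∈S} ∏_i g_{p,i}(z_i) dz = Σ_{p∈S} ∏_i ∫_0^1 g_{p,i}` for measurable factors
with `|g_{p,i}| ≤ 1` on `[0,1]`. [folklore] -/
private theorem integral_cube_sum_prod {ι : Type*} (S : Finset ι) (g : ι → Fin s → ℝ → ℝ)
    (hm : ∀ p ∈ S, ∀ i, Measurable (g p i))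
    (hb : ∀ p ∈ S, ∀ i, ∀ t ∈ Icc (0 : ℝ) 1, |g p i t| ≤ 1) :
    ∫ z in Icc (0 : Fin s → ℝ) 1, ∑ p ∈ S, ∏ i, g p i (z i) =
      ∑ p ∈ S, ∏ i, ∫ t in Icc (0 : ℝ) 1, g p i t := by
  rw [integral_finsetSum S (fun p hp => integrableOn_cube_prod (hm p hp) (hb p hp))]
  exact sum_congr rfl fun p _ => integral_cube_prod_univ (g p)

/-- A sum of such products is integrable on the cube. [folklore] -/
private theorem integrableOn_cube_sum_prod {ι : Type*} (S : Finset ι) (g : ι → Fin s → ℝ → ℝ)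
    (hm : ∀ p ∈ S, ∀ i, Measurable (g p i))
    (hb : ∀ p ∈ S, ∀ i, ∀ t ∈ Icc (0 : ℝ) 1, |g p i t| ≤ 1) :
    IntegrableOn (fun z : Fin s → ℝ => ∑ p ∈ S, ∏ i, g p i (z i)) (Icc (0 : Fin s → ℝ) 1) :=
  integrable_finsetSum S fun p hp => integrableOn_cube_prod (hm p hp) (hb p hp)

/-! ### Roth's auxiliary function -/

section Construction

variable (x : Fin N → Fin s → ℝ)

/-- All dyadic boxes of shape `r`: lattice points `h` with `0 ≤ h_i < 2^{r_i}`.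
[cite: DickPillichshammer2010, proof of Lemma 3.23 (the lattice points `h`, eq. (3.8))] -/
def rothGrid (r : Fin s → ℕ) : Finset (Fin s → ℕ) := Fintype.piFinset fun i => range (2 ^ r i)

/-- The boxes of shape `r` occupied by a point: `(⌊2^{r_1} x_{n,1}⌋, …, ⌊2^{r_s} x_{n,s}⌋)`.
[cite: DickPillichshammer2010, §3.2 (notation before Lemma 3.22: definition of `G_r`)] -/
def rothOccupied (r : Fin s → ℕ) : Finset (Fin s → ℕ) :=
  univ.image fun n : Fin N => fun i => ⌊(2 : ℝ) ^ r i * x n i⌋₊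

/-- The EMPTY boxes of shape `r` (where `G_r ≠ 0`).
[cite: DickPillichshammer2010, §3.2 (notation before Lemma 3.22)] -/
def rothEmpty (r : Fin s → ℕ) : Finset (Fin s → ℕ) := rothGrid r \ rothOccupied x r

/-- The index set of Roth's auxiliary function: pairs `(r, h)` with `|r|₁ = d` and `h` an empty
box of shape `r`. [cite: DickPillichshammer2010, §3.2 (notation before Lemma 3.22, `F = Σ_{|r|₁ = t−1} F_r`)] -/
def rothPairs (d : ℕ) : Finset ((Fin s → ℕ) × (Fin s → ℕ)) :=
  ((Finset.Nat.antidiagonalTuple s d).sigma fun r => rothEmpty x r).map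
    (Equiv.sigmaEquivProd _ _).toEmbedding

/-- Roth's auxiliary function `F(z) = Σ_{|r|₁ = d} F_r(z) = Σ_{(r,h)} ∏_i ψ_{r_i,h_i}(z_i)`
(`F_r(z) = G_r(2^{r_1}z_1,…,2^{r_s}z_s)`, `G_r = 0` on occupied boxes and `= ∏ ψ` otherwise).
[cite: DickPillichshammer2010, §3.2 (notation before Lemma 3.22)] -/
def rothF (d : ℕ) (z : Fin s → ℝ) : ℝ := ∑ p ∈ rothPairs x d, ∏ i, rothPsi (p.1 i) (p.2 i) (z i)

/-- Membership in the set of empty boxes. [folklore] -/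
private theorem mem_rothEmpty {r h : Fin s → ℕ} :
    h ∈ rothEmpty x r ↔ (∀ i, h i < 2 ^ r i) ∧ ∀ n, h ≠ fun i => ⌊(2 : ℝ) ^ r i * x n i⌋₊ := by
  unfold rothEmpty rothGrid rothOccupied
  simp only [Finset.mem_sdiff, Fintype.mem_piFinset, Finset.mem_range, Finset.mem_image,
    Finset.mem_univ, true_and, not_exists]
  exact ⟨fun ⟨h1, h2⟩ => ⟨h1, fun n e => h2 n e.symm⟩, fun ⟨h1, h2⟩ => ⟨h1, fun n e => h2 n e.symm⟩⟩

/-- Membership in the index set of `F`. [folklore] -/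
private theorem mem_rothPairs {d : ℕ} {p : (Fin s → ℕ) × (Fin s → ℕ)} :
    p ∈ rothPairs x d ↔ ∑ i, p.1 i = d ∧ p.2 ∈ rothEmpty x p.1 := by
  unfold rothPairs
  rw [Finset.mem_map_equiv, Finset.mem_sigma, Finset.Nat.mem_antidiagonalTuple]
  rfl

/-- There are `2^{|r|₁}` boxes of shape `r`. [cite: DickPillichshammer2010, proof of Lemma 3.23] -/
theorem card_rothGrid (r : Fin s → ℕ) : (rothGrid r).card = 2 ^ ∑ i, r i := by
  unfold rothGrid
  rw [Fintype.card_piFinset]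
  simp_rw [card_range]
  rw [prod_pow_eq_pow_sum]

/-- At most `N` boxes are occupied. [cite: DickPillichshammer2010, proof of Lemma 3.23] -/
theorem card_rothOccupied_le (r : Fin s → ℕ) : (rothOccupied x r).card ≤ N :=
  card_image_le.trans (by simp)

/-- At most `2^{|r|₁}` empty boxes of shape `r`. [folklore] -/
private theorem card_rothEmpty_le (r : Fin s → ℕ) : (rothEmpty x r).card ≤ 2 ^ ∑ i, r i := by
  unfold rothEmpty
  rw [← card_rothGrid r]
  exact card_le_card sdiff_subset

/-- "this sum is extended over at least `2^{|r|₁} − N` lattice points".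
[cite: DickPillichshammer2010, proof of Lemma 3.23] -/
theorem le_card_rothEmpty_add (r : Fin s → ℕ) : 2 ^ (∑ i, r i) ≤ (rothEmpty x r).card + N := by
  unfold rothEmpty
  calc 2 ^ ∑ i, r i = (rothGrid r).card := (card_rothGrid r).symm
    _ ≤ (rothGrid r \ rothOccupied x r).card + (rothOccupied x r).card :=
        card_le_card_sdiff_add_card
    _ ≤ (rothGrid r \ rothOccupied x r).card + N := by
        gcongr; exact card_rothOccupied_le x r

/-- `#pairs = Σ_{|r|₁ = d} #(empty boxes of shape r)`. [folklore] -/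
private theorem card_rothPairs (d : ℕ) :
    (rothPairs x d).card = ∑ r ∈ Finset.Nat.antidiagonalTuple s d, (rothEmpty x r).card := by
  unfold rothPairs
  rw [card_map, card_sigma]

/-- `#pairs ≤ binom · 2^d`: "`F_r² ≤ 1` and hence the first sum is bounded by `binom(t−1+s−1, s−1)`".
[cite: DickPillichshammer2010, proof of Lemma 3.24] -/
theorem card_rothPairs_le (d : ℕ) :
    ((rothPairs x d).card : ℝ) ≤ (Finset.Nat.antidiagonalTuple s d).card * 2 ^ d := by
  rw [card_rothPairs]
  push_cast
  calc ∑ r ∈ Finset.Nat.antidiagonalTuple s d, ((rothEmpty x r).card : ℝ)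
      ≤ ∑ r ∈ Finset.Nat.antidiagonalTuple s d, (2 : ℝ) ^ d := sum_le_sum fun r hr => by
        rw [Finset.Nat.mem_antidiagonalTuple] at hr
        rw [← hr]
        exact_mod_cast card_rothEmpty_le x r
    _ = (Finset.Nat.antidiagonalTuple s d).card * 2 ^ d := by rw [sum_const, nsmul_eq_mul]

/-- `#pairs ≥ binom · (2^d − N)`: each shape contributes at least `2^{t−1} − N` empty boxes.
[cite: DickPillichshammer2010, proof of Lemma 3.23] -/
theorem le_card_rothPairs (d : ℕ) :
    ((Finset.Nat.antidiagonalTuple s d).card : ℝ) * ((2 : ℝ) ^ d - N) ≤ (rothPairs x d).card := by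
  rw [card_rothPairs]
  push_cast
  calc ((Finset.Nat.antidiagonalTuple s d).card : ℝ) * ((2 : ℝ) ^ d - N)
      = ∑ r ∈ Finset.Nat.antidiagonalTuple s d, ((2 : ℝ) ^ d - N) := by
        rw [sum_const, nsmul_eq_mul]
    _ ≤ ∑ r ∈ Finset.Nat.antidiagonalTuple s d, ((rothEmpty x r).card : ℝ) :=
        sum_le_sum fun r hr => by
          rw [Finset.Nat.mem_antidiagonalTuple] at hr
          have h1 := le_card_rothEmpty_add x r
          rw [hr] at h1
          have h2 : ((2 ^ d : ℕ) : ℝ) ≤ (((rothEmpty x r).card + N : ℕ) : ℝ) := by exact_mod_cast h1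
          push_cast at h2
          linarith

/-- The number of shapes `r ∈ ℕ₀^s` with `|r|₁ = d` is `binom(d+s−1, s−1)`.
[cite: DickPillichshammer2010, proof of Lemma 3.23 (last sentence)] -/
theorem card_shapes (hs : 1 ≤ s) (d : ℕ) :
    (Finset.Nat.antidiagonalTuple s d).card = (d + s - 1).choose (s - 1) := by
  obtain ⟨k, rfl⟩ : ∃ k, s = k + 1 := ⟨s - 1, by omega⟩
  rw [Literature.Combinatorics.Enumerative.card_antidiagonalTuple_succ k d]
  have e1 : d + (k + 1) - 1 = d + k := by omega
  have e2 : k + 1 - 1 = k := by omega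
  rw [e1, e2]

/-- `F` is measurable. [folklore] -/
private theorem measurable_rothF (d : ℕ) : Measurable (rothF x d) :=
  Finset.measurable_sum _ fun _ _ =>
    Finset.measurable_prod _ fun i _ => (measurable_rothPsi _ _).comp (measurable_pi_apply i)

/-- `|F| ≤ #pairs`. [folklore] -/
private theorem abs_rothF_le (d : ℕ) (z : Fin s → ℝ) : |rothF x d z| ≤ (rothPairs x d).card := by
  unfold rothF
  refine (abs_sum_le_sum_abs _ _).trans ?_
  calc ∑ p ∈ rothPairs x d, |∏ i, rothPsi (p.1 i) (p.2 i) (z i)|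
      ≤ ∑ p ∈ rothPairs x d, (1 : ℝ) := sum_le_sum fun p _ => by
        rw [Finset.abs_prod]
        exact prod_le_one (fun i _ => abs_nonneg _) fun i _ => abs_rothPsi_le_one _ _ _
    _ = (rothPairs x d).card := by rw [sum_const, nsmul_eq_mul, mul_one]

/-- `(∏_i a_i(z_i)) F(z) = Σ_{(r,h)} ∏_i a_i(z_i) ψ_{r_i,h_i}(z_i)`. [folklore] -/
private theorem prod_mul_rothF (a : Fin s → ℝ → ℝ) (d : ℕ) (z : Fin s → ℝ) :
    (∏ i, a i (z i)) * rothF x d z =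
      ∑ p ∈ rothPairs x d, ∏ i, (a i (z i) * rothPsi (p.1 i) (p.2 i) (z i)) := by
  unfold rothF
  rw [mul_sum]
  exact sum_congr rfl fun p _ => by rw [prod_mul_distrib]

/-- `z ↦ (∏_i a_i(z_i)) F(z)` is integrable on the cube for measurable `a_i` with `|a_i| ≤ 1` on
`[0,1]`. [folklore] -/
private theorem integrableOn_prod_mul_rothF {a : Fin s → ℝ → ℝ} (hm : ∀ i, Measurable (a i))
    (hb : ∀ i, ∀ t ∈ Icc (0 : ℝ) 1, |a i t| ≤ 1) (d : ℕ) :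
    IntegrableOn (fun z => (∏ i, a i (z i)) * rothF x d z) (Icc (0 : Fin s → ℝ) 1) := by
  have h : (fun z => (∏ i, a i (z i)) * rothF x d z) =
      fun z => ∑ p ∈ rothPairs x d, ∏ i, (a i (z i) * rothPsi (p.1 i) (p.2 i) (z i)) :=
    funext fun z => prod_mul_rothF x a d z
  rw [h]
  exact integrableOn_cube_sum_prod (rothPairs x d) (fun p i t => a i t * rothPsi (p.1 i) (p.2 i) t)
    (fun p _ i => (hm i).mul (measurable_rothPsi _ _))
    (fun p _ i t ht => abs_mul_rothPsi_le_one (hb i t ht) _ _ _)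

/-- **Lemma 3.23** (exact form): `∫_{[0,1]^s} z_1 ⋯ z_s F(z) dz = #pairs · 4^{−(d+s)}`
(`≥ binom(d+s−1,s−1) (2^d − N) / 2^{2(d+s)}` by `le_card_rothPairs`).
[cite: DickPillichshammer2010, Lemma 3.23] -/
theorem roth_integral_prod_mul_rothF (d : ℕ) :
    ∫ z in Icc (0 : Fin s → ℝ) 1, (∏ i, z i) * rothF x d z = (rothPairs x d).card / 4 ^ (d + s) := by
  have hpt : (fun z : Fin s → ℝ => (∏ i, z i) * rothF x d z) =
      fun z => ∑ p ∈ rothPairs x d, ∏ i, (z i * rothPsi (p.1 i) (p.2 i) (z i)) :=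
    funext fun z => prod_mul_rothF x (fun _ t => t) d z
  rw [hpt, integral_cube_sum_prod (rothPairs x d) (fun p i t => t * rothPsi (p.1 i) (p.2 i) t)
    (fun p _ i => measurable_id.mul (measurable_rothPsi _ _))
    (fun p _ i t ht => abs_mul_rothPsi_le_one (abs_le_one_of_mem_Icc ht) _ _ _)]
  have hterm : ∀ p ∈ rothPairs x d,
      ∏ i, ∫ t in Icc (0 : ℝ) 1, t * rothPsi (p.1 i) (p.2 i) t = 1 / 4 ^ (d + s) := by
    intro p hp
    obtain ⟨hsum, hmem⟩ := (mem_rothPairs x).1 hp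
    obtain ⟨hlt, -⟩ := (mem_rothEmpty x).1 hmem
    rw [prod_congr rfl fun i _ => integral_id_mul_rothPsi (hlt i), Finset.prod_div_distrib,
      prod_const_one, prod_pow_eq_pow_sum]
    congr 2
    rw [sum_add_distrib, hsum, sum_const, card_univ, Fintype.card_fin, smul_eq_mul, mul_one]
  rw [sum_congr rfl hterm, sum_const, nsmul_eq_mul, mul_one_div]

/-- **Lemma 3.25**: `∫_{J_n} F = ∫_{[0,1]^s} ∏_i 1[x_{n,i} < z_i] F(z) dz = 0` for every point `x_n`
(`J_n = ∏_i (x_{n,i}, 1]`): the box of shape `r` containing `x_n` is occupied, so for every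
term some coordinate integral is over whole dyadic intervals or empty (Lemma 3.22).
[cite: DickPillichshammer2010, Lemma 3.25] -/
theorem roth_integral_ind_mul_rothF (d : ℕ) (n : Fin N) :
    ∫ z in Icc (0 : Fin s → ℝ) 1, (∏ i, if x n i < z i then (1 : ℝ) else 0) * rothF x d z = 0 := by
  have hpt : (fun z : Fin s → ℝ => (∏ i, if x n i < z i then (1 : ℝ) else 0) * rothF x d z) =
      fun z => ∑ p ∈ rothPairs x d,
        ∏ i, ((if x n i < z i then (1 : ℝ) else 0) * rothPsi (p.1 i) (p.2 i) (z i)) :=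
    funext fun z => prod_mul_rothF x (fun i t => if x n i < t then (1 : ℝ) else 0) d z
  rw [hpt, integral_cube_sum_prod (rothPairs x d)
    (fun p i t => (if x n i < t then (1 : ℝ) else 0) * rothPsi (p.1 i) (p.2 i) t)
    (fun p _ i => (measurable_ind₁ _).mul (measurable_rothPsi _ _))
    (fun p _ i t _ => abs_mul_rothPsi_le_one (abs_ind₁_le_one _ _) _ _ _)]
  refine sum_eq_zero fun p hp => ?_
  obtain ⟨-, hmem⟩ := (mem_rothPairs x).1 hp
  obtain ⟨hlt, hne⟩ := (mem_rothEmpty x).1 hmem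
  have hex : ∃ i, p.2 i ≠ ⌊(2 : ℝ) ^ p.1 i * x n i⌋₊ := by
    by_contra hall
    push Not at hall
    exact hne n (funext hall)
  obtain ⟨i, hi⟩ := hex
  exact prod_eq_zero (mem_univ i) (integral_ind_mul_rothPsi (hlt i) (lt_or_le_of_ne_floor hi))

/-- **Lemma 3.24** (exact form): `∫_{[0,1]^s} F² = #pairs · 2^{−d}` — distinct terms of `F` are
orthogonal. [cite: DickPillichshammer2010, Lemma 3.24] -/
theorem roth_integral_rothF_sq (d : ℕ) :
    ∫ z in Icc (0 : Fin s → ℝ) 1, rothF x d z ^ 2 = (rothPairs x d).card / 2 ^ d := by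
  set P := rothPairs x d with hP
  have hpt : (fun z => rothF x d z ^ 2) = fun z => ∑ pq ∈ P ×ˢ P,
      ∏ i, (rothPsi (pq.1.1 i) (pq.1.2 i) (z i) * rothPsi (pq.2.1 i) (pq.2.2 i) (z i)) := by
    funext z
    unfold rothF
    rw [sq, sum_mul_sum, Finset.sum_product]
    refine sum_congr rfl fun p _ => sum_congr rfl fun q _ => ?_
    rw [prod_mul_distrib]
  rw [hpt, integral_cube_sum_prod (P ×ˢ P)
    (fun pq i t => rothPsi (pq.1.1 i) (pq.1.2 i) t * rothPsi (pq.2.1 i) (pq.2.2 i) t)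
    (fun pq _ i => (measurable_rothPsi _ _).mul (measurable_rothPsi _ _))
    (fun pq _ i t _ => abs_mul_rothPsi_le_one (abs_rothPsi_le_one _ _ _) _ _ _)]
  have hterm : ∀ pq ∈ P ×ˢ P,
      ∏ i, ∫ t in Icc (0 : ℝ) 1, rothPsi (pq.1.1 i) (pq.1.2 i) t * rothPsi (pq.2.1 i) (pq.2.2 i) t =
        if pq.1 = pq.2 then 1 / 2 ^ d else 0 := by
    rintro ⟨p, q⟩ hpq
    rw [Finset.mem_product] at hpq
    obtain ⟨hp, hq⟩ := hpq
    obtain ⟨hpsum, hpmem⟩ := (mem_rothPairs x).1 hp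
    obtain ⟨hplt, -⟩ := (mem_rothEmpty x).1 hpmem
    obtain ⟨-, hqmem⟩ := (mem_rothPairs x).1 hq
    obtain ⟨hqlt, -⟩ := (mem_rothEmpty x).1 hqmem
    dsimp only
    by_cases e : p = q
    · subst e
      rw [if_pos rfl, prod_congr rfl fun i _ => integral_rothPsi_mul_self (hplt i),
        Finset.prod_div_distrib, prod_const_one, prod_pow_eq_pow_sum, hpsum]
    · rw [if_neg e]
      have hex : ∃ i, p.1 i ≠ q.1 i ∨ (p.1 i = q.1 i ∧ p.2 i ≠ q.2 i) := by
        by_contra hall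
        push Not at hall
        exact e (Prod.ext (funext fun i => (hall i).1) (funext fun i => (hall i).2 (hall i).1))
      obtain ⟨i, hi⟩ := hex
      apply prod_eq_zero (mem_univ i)
      rcases hi with hi | ⟨heq, hne⟩
      · exact integral_rothPsi_mul_rothPsi_of_ne hi (hplt i) (hqlt i)
      · have hq' : q.2 i < 2 ^ p.1 i := heq ▸ hqlt i
        rw [← heq, integral_rothPsi_mul_rothPsi (hplt i) hq', if_neg hne]
  rw [sum_congr rfl hterm, Finset.sum_product]
  have hinner : ∀ p ∈ P, (∑ q ∈ P, if (p, q).1 = (p, q).2 then (1 : ℝ) / 2 ^ d else 0) = 1 / 2 ^ d := by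
    intro p hp
    dsimp only
    rw [Finset.sum_ite_eq, if_pos hp]
  rw [sum_congr rfl hinner, sum_const, nsmul_eq_mul, mul_one_div]

/-- **Lemma 3.24**: `∫_{[0,1]^s} F² ≤ binom(d+s−1, s−1)`. [cite: DickPillichshammer2010, Lemma 3.24] -/
theorem roth_integral_rothF_sq_le (hs : 1 ≤ s) (d : ℕ) :
    ∫ z in Icc (0 : Fin s → ℝ) 1, rothF x d z ^ 2 ≤ ((d + s - 1).choose (s - 1) : ℝ) := by
  rw [roth_integral_rothF_sq, ← card_shapes hs d, div_le_iff₀ (by positivity)]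
  exact card_rothPairs_le x d

end Construction

/-! ### Roth's theorem -/

section Roth

variable (x : Fin N → Fin s → ℝ)

/-- `#{n : x_n ∈ [0,z)} = Σ_n ∏_i 1[x_{n,i} < z_i]`: "`A([0,x), N, P) = Σ_n χ_{J_n}(x)`".
[cite: DickPillichshammer2010, proof of Thm. 3.20] -/
private theorem boxCount_eq_sum₀ (z : Fin s → ℝ) :
    (boxCount x z : ℝ) = ∑ n, ∏ i, (if x n i < z i then (1 : ℝ) else 0) := by
  unfold boxCount
  rw [card_filter]
  push_cast
  refine sum_congr rfl fun n _ => ?_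
  by_cases h : ∀ i, x n i < z i
  · rw [if_pos h]
    exact (prod_eq_one fun i _ => if_pos (h i)).symm
  · rw [if_neg h]
    push Not at h
    obtain ⟨i, hi⟩ := h
    exact (prod_eq_zero (mem_univ i) (if_neg (not_lt.2 hi))).symm

/-- `Δ_P` is measurable. [folklore] -/
private theorem measurable_boxDelta₀ : Measurable (boxDelta x) := by
  have h : boxDelta x = fun z => (∑ n, ∏ i, (if x n i < z i then (1 : ℝ) else 0)) / N - ∏ i, z i := by
    funext z; rw [boxDelta, boxCount_eq_sum₀]
  rw [h]
  refine Measurable.sub (Measurable.div_const (Finset.measurable_sum _ fun n _ => ?_) _)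
    (Finset.measurable_prod _ fun i _ => measurable_pi_apply i)
  exact Finset.measurable_prod _ fun i _ =>
    Measurable.ite (measurableSet_lt measurable_const (measurable_pi_apply i)) measurable_const
      measurable_const

/-- Cauchy–Schwarz on the cube for bounded measurable functions:
`(∫ f g)² ≤ (∫ f²)(∫ g²)`. [folklore] -/
private theorem sq_integral_mul_le {f g : (Fin s → ℝ) → ℝ} (hf : Measurable f) (hg : Measurable g)
    (Cf Cg : ℝ) (hCf : ∀ z ∈ Icc (0 : Fin s → ℝ) 1, |f z| ≤ Cf) (hCg : ∀ z, |g z| ≤ Cg) :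
    (∫ z in Icc (0 : Fin s → ℝ) 1, f z * g z) ^ 2 ≤
      (∫ z in Icc (0 : Fin s → ℝ) 1, f z ^ 2) * (∫ z in Icc (0 : Fin s → ℝ) 1, g z ^ 2) := by
  haveI := isFiniteMeasure_cube₀ s
  set μ : Measure (Fin s → ℝ) := (volume : Measure (Fin s → ℝ)).restrict (Icc 0 1) with hμ
  have hfL : MemLp (fun z => |f z|) (ENNReal.ofReal 2) μ :=
    MemLp.of_bound hf.aestronglyMeasurable.norm Cf
      ((ae_restrict_iff' measurableSet_Icc).2 (Filter.Eventually.of_forall fun z hz => by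
        rw [Real.norm_eq_abs, abs_abs]; exact hCf z hz))
  have hgL : MemLp (fun z => |g z|) (ENNReal.ofReal 2) μ :=
    MemLp.of_bound hg.aestronglyMeasurable.norm Cg
      (Filter.Eventually.of_forall fun z => by rw [Real.norm_eq_abs, abs_abs]; exact hCg z)
  have hpq : (2 : ℝ).HolderConjugate 2 := by
    rw [Real.holderConjugate_iff]; norm_num
  have hH := integral_mul_le_Lp_mul_Lq_of_nonneg (μ := μ) hpq
    (Filter.Eventually.of_forall fun z => abs_nonneg _)
    (Filter.Eventually.of_forall fun z => abs_nonneg _) hfL hgL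
  have e1 : (fun z => |f z| ^ (2 : ℝ)) = fun z => f z ^ 2 := by
    funext z; rw [Real.rpow_two, sq_abs]
  have e2 : (fun z => |g z| ^ (2 : ℝ)) = fun z => g z ^ 2 := by
    funext z; rw [Real.rpow_two, sq_abs]
  rw [e1, e2, ← Real.sqrt_eq_rpow, ← Real.sqrt_eq_rpow] at hH
  have hA0 : 0 ≤ ∫ z in Icc (0 : Fin s → ℝ) 1, f z ^ 2 := integral_nonneg fun z => sq_nonneg _
  have hB0 : 0 ≤ ∫ z in Icc (0 : Fin s → ℝ) 1, g z ^ 2 := integral_nonneg fun z => sq_nonneg _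
  have habs : |∫ z in Icc (0 : Fin s → ℝ) 1, f z * g z| ≤
      Real.sqrt (∫ z in Icc (0 : Fin s → ℝ) 1, f z ^ 2) *
        Real.sqrt (∫ z in Icc (0 : Fin s → ℝ) 1, g z ^ 2) := by
    calc |∫ z in Icc (0 : Fin s → ℝ) 1, f z * g z|
        ≤ ∫ z in Icc (0 : Fin s → ℝ) 1, |f z * g z| := abs_integral_le_integral_abs
      _ = ∫ z in Icc (0 : Fin s → ℝ) 1, |f z| * |g z| := by
          congr 1; funext z; exact abs_mul _ _
      _ ≤ _ := hH
  have h0 : 0 ≤ Real.sqrt (∫ z in Icc (0 : Fin s → ℝ) 1, f z ^ 2) *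
      Real.sqrt (∫ z in Icc (0 : Fin s → ℝ) 1, g z ^ 2) := by positivity
  calc (∫ z in Icc (0 : Fin s → ℝ) 1, f z * g z) ^ 2
      = |∫ z in Icc (0 : Fin s → ℝ) 1, f z * g z| ^ 2 := (sq_abs _).symm
    _ ≤ (Real.sqrt (∫ z in Icc (0 : Fin s → ℝ) 1, f z ^ 2) *
          Real.sqrt (∫ z in Icc (0 : Fin s → ℝ) 1, g z ^ 2)) ^ 2 :=
        pow_le_pow_left₀ (abs_nonneg _) habs 2
    _ = (∫ z in Icc (0 : Fin s → ℝ) 1, f z ^ 2) * (∫ z in Icc (0 : Fin s → ℝ) 1, g z ^ 2) := by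
        rw [mul_pow, Real.sq_sqrt hA0, Real.sq_sqrt hB0]

/-- "`∫ (−N Δ_P) F = N ∫ z_1⋯z_s F`" (the counting part integrates to zero by Lemma 3.25).
[cite: DickPillichshammer2010, proof of Thm. 3.20] -/
theorem roth_integral_boxDelta_mul_rothF (hN : 0 < N) (d : ℕ) :
    ∫ z in Icc (0 : Fin s → ℝ) 1, (-((N : ℝ) * boxDelta x z)) * rothF x d z =
      N * ((rothPairs x d).card / 4 ^ (d + s)) := by
  have hN' : (N : ℝ) ≠ 0 := by exact_mod_cast hN.ne'
  have hpt : (fun z => (-((N : ℝ) * boxDelta x z)) * rothF x d z) = fun z =>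
      (N : ℝ) * ((∏ i, z i) * rothF x d z) -
        ∑ n, ((∏ i, if x n i < z i then (1 : ℝ) else 0) * rothF x d z) := by
    funext z
    rw [← sum_mul, boxDelta, boxCount_eq_sum₀ x z]
    field_simp
    ring
  have hI0 : IntegrableOn (fun z => (∏ i, z i) * rothF x d z) (Icc (0 : Fin s → ℝ) 1) :=
    integrableOn_prod_mul_rothF x (fun _ => measurable_id) (fun _ t ht => abs_le_one_of_mem_Icc ht) d
  have hIn : ∀ n : Fin N, IntegrableOn
      (fun z => (∏ i, if x n i < z i then (1 : ℝ) else 0) * rothF x d z) (Icc (0 : Fin s → ℝ) 1) :=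
    fun n => integrableOn_prod_mul_rothF x (fun i => measurable_ind₁ (x n i))
      (fun i t _ => abs_ind₁_le_one _ _) d
  rw [hpt, integral_sub (hI0.const_mul _) (integrable_finsetSum _ fun n _ => hIn n),
    integral_const_mul, integral_finsetSum _ (fun n _ => hIn n), roth_integral_prod_mul_rothF,
    sum_eq_zero fun n _ => roth_integral_ind_mul_rothF x d n, sub_zero]

/-- **Roth's inequality, core form**: for `N ≤ 2^d`,
`∫_{[0,1]^s} (N Δ_P(z))² dz ≥ N² binom(d+s−1, s−1) 2^{−4(d+s)} (2^d − N)²`.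
[cite: DickPillichshammer2010, proof of Thm. 3.20 (the display before the choice of `t`)] -/
theorem roth_sq_lower_bound_core (hs : 1 ≤ s) (hN : 0 < N) {d : ℕ} (hd : N ≤ 2 ^ d) :
    (N : ℝ) ^ 2 * ((d + s - 1).choose (s - 1) : ℝ) * ((2 : ℝ) ^ d - N) ^ 2 / 2 ^ (4 * (d + s)) ≤
      (N : ℝ) ^ 2 * l2DiscrepancySq x := by
  set M : ℝ := ((d + s - 1).choose (s - 1) : ℝ) with hM
  set P : ℝ := ((rothPairs x d).card : ℝ) with hP
  have hR : ((Finset.Nat.antidiagonalTuple s d).card : ℝ) = M := by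
    rw [hM]; exact_mod_cast card_shapes hs d
  have hMpos : 0 < M := by
    rw [hM]; exact_mod_cast Nat.choose_pos (by omega)
  have hdN : 0 ≤ (2 : ℝ) ^ d - N := by
    have : ((N : ℕ) : ℝ) ≤ ((2 ^ d : ℕ) : ℝ) := by exact_mod_cast hd
    push_cast at this; linarith
  have hPlo : M * ((2 : ℝ) ^ d - N) ≤ P := hR ▸ le_card_rothPairs x d
  have hPhi : P ≤ M * 2 ^ d := hR ▸ card_rothPairs_le x d
  -- the three integrals
  set X : ℝ := (N : ℝ) ^ 2 * l2DiscrepancySq x with hX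
  have hXint : ∫ z in Icc (0 : Fin s → ℝ) 1, (-((N : ℝ) * boxDelta x z)) ^ 2 = X := by
    rw [hX, l2DiscrepancySq, ← integral_const_mul]
    congr 1; funext z; ring
  have hA : ∫ z in Icc (0 : Fin s → ℝ) 1, rothF x d z ^ 2 = P / 2 ^ d := roth_integral_rothF_sq x d
  have hB : ∫ z in Icc (0 : Fin s → ℝ) 1, (-((N : ℝ) * boxDelta x z)) * rothF x d z =
      N * (P / 4 ^ (d + s)) := roth_integral_boxDelta_mul_rothF x hN d
  -- Cauchy–Schwarz
  have hCS := sq_integral_mul_le (f := fun z => -((N : ℝ) * boxDelta x z)) (g := rothF x d)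
    ((measurable_boxDelta₀ x).const_mul _).neg (measurable_rothF x d) N (rothPairs x d).card
    (fun z hz => by
      rw [abs_neg, abs_mul, Nat.abs_cast]
      exact mul_le_of_le_one_right (Nat.cast_nonneg _)
        ((abs_boxDelta_le_starDiscrepancy x hz).trans (starDiscrepancy_le_one x)))
    (abs_rothF_le x d)
  rw [hXint, hA, hB] at hCS
  -- `L² ≤ B² ≤ X · A ≤ X · M`
  have hX0 : 0 ≤ X := by rw [← hXint]; exact integral_nonneg fun z => sq_nonneg _
  have hL0 : 0 ≤ (N : ℝ) * (M * ((2 : ℝ) ^ d - N) / 4 ^ (d + s)) := by positivity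
  have hLB : (N : ℝ) * (M * ((2 : ℝ) ^ d - N) / 4 ^ (d + s)) ≤ N * (P / 4 ^ (d + s)) := by
    gcongr
  have hAM : P / 2 ^ d ≤ M := by
    rw [div_le_iff₀ (by positivity)]; exact hPhi
  have key : ((N : ℝ) * (M * ((2 : ℝ) ^ d - N) / 4 ^ (d + s))) ^ 2 ≤ X * M :=
    calc ((N : ℝ) * (M * ((2 : ℝ) ^ d - N) / 4 ^ (d + s))) ^ 2
        ≤ ((N : ℝ) * (P / 4 ^ (d + s))) ^ 2 := pow_le_pow_left₀ hL0 hLB 2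
      _ ≤ X * (P / 2 ^ d) := hCS
      _ ≤ X * M := mul_le_mul_of_nonneg_left hAM hX0
  have h4 : (4 : ℝ) ^ (d + s) = 2 ^ (2 * (d + s)) := by
    rw [pow_mul]; norm_num
  have h24 : (2 : ℝ) ^ (4 * (d + s)) = (2 ^ (2 * (d + s))) ^ 2 := by
    rw [← pow_mul]; congr 1; ring
  rw [h4] at key
  have hrw : (N : ℝ) ^ 2 * M * ((2 : ℝ) ^ d - N) ^ 2 / 2 ^ (4 * (d + s)) =
      ((N : ℝ) * (M * ((2 : ℝ) ^ d - N) / 2 ^ (2 * (d + s)))) ^ 2 / M := by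
    rw [h24]
    field_simp
  rw [hrw, div_le_iff₀ hMpos]
  exact key

/-- `2 + ⌊log₂ N⌋` is the exponent `d` with `2N < 2^d ≤ 4N`. [cite: DickPillichshammer2010,
proof of Thm. 3.20 ("Let `t` now be the unique integer for which `2N < 2^{t−1} ≤ 4N`")] -/
private theorem two_pow_log_add_two (hN : 0 < N) :
    2 * N < 2 ^ (Nat.log 2 N + 2) ∧ 2 ^ (Nat.log 2 N + 2) ≤ 4 * N := by
  have h1 : 2 ^ Nat.log 2 N ≤ N := Nat.pow_log_le_self 2 hN.ne'
  have h2 : N < 2 ^ (Nat.log 2 N).succ := Nat.lt_pow_succ_log_self one_lt_two N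
  rw [Nat.succ_eq_add_one, pow_succ] at h2
  constructor
  · rw [pow_succ, pow_succ]; omega
  · rw [pow_succ, pow_succ]; omega

/-- **Roth's inequality, binomial form**:
`∫_{[0,1]^s} (N Δ_P(z))² dz ≥ binom(⌊log₂ N⌋ + s + 1, s − 1) / 2^{4s+8}`.
[cite: DickPillichshammer2010, proof of Thm. 3.20] -/
theorem roth_sq_lower_bound_choose (hs : 1 ≤ s) (hN : 0 < N) :
    ((Nat.log 2 N + s + 1).choose (s - 1) : ℝ) / 2 ^ (4 * s + 8) ≤ (N : ℝ) ^ 2 * l2DiscrepancySq x := by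
  obtain ⟨h1, h2⟩ := two_pow_log_add_two hN
  set L := Nat.log 2 N with hL
  have hcore := roth_sq_lower_bound_core x hs hN (d := L + 2) (by omega)
  have e : L + 2 + s - 1 = L + s + 1 := by omega
  rw [e] at hcore
  refine le_trans ?_ hcore
  set C : ℝ := ((L + s + 1).choose (s - 1) : ℝ)
  set a : ℝ := (2 : ℝ) ^ (L + 2) with ha
  have hC0 : 0 ≤ C := Nat.cast_nonneg _
  have ha1 : 2 * (N : ℝ) < a := by rw [ha]; exact_mod_cast h1
  have ha2 : a ≤ 4 * N := by rw [ha]; exact_mod_cast h2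
  have hN0 : (0 : ℝ) < N := by exact_mod_cast hN
  have e1 : (2 : ℝ) ^ (4 * (L + 2 + s)) = a ^ 4 * 2 ^ (4 * s) := by
    rw [ha, ← pow_mul, ← pow_add]; congr 1; ring
  have e2 : (2 : ℝ) ^ (4 * s + 8) = 256 * 2 ^ (4 * s) := by
    rw [pow_add]; norm_num; ring
  rw [e1, e2, div_le_div_iff₀ (by positivity) (by positivity)]
  have h3 : (N : ℝ) ≤ a - N := by linarith
  calc C * (a ^ 4 * 2 ^ (4 * s)) ≤ C * ((4 * N) ^ 4 * 2 ^ (4 * s)) := by gcongr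
    _ = (N : ℝ) ^ 2 * C * (N : ℝ) ^ 2 * (256 * 2 ^ (4 * s)) := by ring
    _ ≤ (N : ℝ) ^ 2 * C * (a - N) ^ 2 * (256 * 2 ^ (4 * s)) := by gcongr

/-- **Roth's lower bound on the `L₂`-discrepancy** (first printed inequality of Theorem 3.20):
`L_{2,N}(P) ≥ (1/N) √(binom(⌊log₂ N⌋ + s + 1, s − 1)) · 2^{−(2s+4)}` for every `N`-point set in
the `s`-dimensional unit cube (`s ≥ 1`, `N ≥ 1`).
[cite: DickPillichshammer2010, Thm. 3.20; Roth1954] -/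
theorem roth_lower_bound_choose (hs : 1 ≤ s) (hN : 0 < N) :
    1 / (N : ℝ) * Real.sqrt ((Nat.log 2 N + s + 1).choose (s - 1)) * (1 / 2 ^ (2 * s + 4)) ≤
      Real.sqrt (l2DiscrepancySq x) := by
  have hN0 : (0 : ℝ) < N := by exact_mod_cast hN
  have h := Real.sqrt_le_sqrt (roth_sq_lower_bound_choose x hs hN)
  have e1 : (2 : ℝ) ^ (4 * s + 8) = (2 ^ (2 * s + 4)) ^ 2 := by
    rw [← pow_mul]; congr 1; ring
  rw [e1, Real.sqrt_div' _ (by positivity), Real.sqrt_sq (by positivity),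
    Real.sqrt_mul (by positivity), Real.sqrt_sq hN0.le] at h
  have e2 : 1 / (N : ℝ) * Real.sqrt ((Nat.log 2 N + s + 1).choose (s - 1)) * (1 / 2 ^ (2 * s + 4)) =
      Real.sqrt ((Nat.log 2 N + s + 1).choose (s - 1)) / 2 ^ (2 * s + 4) / N := by
    field_simp
  rw [e2, div_le_iff₀ hN0]
  exact h.trans_eq (mul_comm _ _)

/-- `binom(⌊log₂ N⌋ + s + 1, s − 1) ≥ (⌊log₂ N⌋ + 3)^{s−1}/(s−1)! ≥ (log₂ N)^{s−1}/(s−1)!`.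
[cite: DickPillichshammer2010, proof of Thm. 3.20 (last display)] -/
theorem log_pow_le_choose (hs : 1 ≤ s) (hN : 0 < N) :
    Real.log N ^ (s - 1) / (Real.log 2 ^ (s - 1) * (s - 1).factorial) ≤
      ((Nat.log 2 N + s + 1).choose (s - 1) : ℝ) := by
  set L := Nat.log 2 N with hL
  have hN0 : (0 : ℝ) < N := by exact_mod_cast hN
  have hlog2 : 0 < Real.log 2 := Real.log_pos one_lt_two
  have hlogN : 0 ≤ Real.log N := Real.log_nonneg (by exact_mod_cast hN)
  -- `log N ≤ (L+1) log 2`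
  have h2 : N < 2 ^ (L + 1) := Nat.lt_pow_succ_log_self one_lt_two N
  have hle : Real.log N ≤ (L + 1 : ℝ) * Real.log 2 := by
    have h := Real.log_le_log hN0 (show (N : ℝ) ≤ (2 : ℝ) ^ (L + 1) by exact_mod_cast h2.le)
    rw [Real.log_pow] at h
    push_cast at h
    exact h
  have hratio : Real.log N / Real.log 2 ≤ (L : ℝ) + 3 := by
    rw [div_le_iff₀ hlog2]; linarith
  -- `(L+3)^{s-1} ≤ (s-1)! binom(L+s+1, s-1)`
  have hdesc : (L + 3) ^ (s - 1) ≤ (s - 1).factorial * (L + s + 1).choose (s - 1) := by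
    have h := Nat.pow_sub_le_descFactorial (L + s + 1) (s - 1)
    rw [Nat.descFactorial_eq_factorial_mul_choose] at h
    have e : L + s + 1 + 1 - (s - 1) = L + 3 := by omega
    rwa [e] at h
  have hdesc' : ((L : ℝ) + 3) ^ (s - 1) ≤ ((s - 1).factorial : ℝ) * ((L + s + 1).choose (s - 1) : ℝ) := by
    exact_mod_cast hdesc
  have hfac : (0 : ℝ) < (s - 1).factorial := by exact_mod_cast Nat.factorial_pos _
  have key : (Real.log N / Real.log 2) ^ (s - 1) ≤
      ((s - 1).factorial : ℝ) * ((L + s + 1).choose (s - 1) : ℝ) :=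
    calc (Real.log N / Real.log 2) ^ (s - 1) ≤ ((L : ℝ) + 3) ^ (s - 1) :=
          pow_le_pow_left₀ (div_nonneg hlogN hlog2.le) hratio _
      _ ≤ ((s - 1).factorial : ℝ) * ((L + s + 1).choose (s - 1) : ℝ) := hdesc'
  rw [div_pow, div_le_iff₀ (pow_pos hlog2 _)] at key
  rw [div_le_iff₀ (by positivity)]
  calc Real.log N ^ (s - 1) ≤ ((s - 1).factorial : ℝ) * ((L + s + 1).choose (s - 1) : ℝ) *
        Real.log 2 ^ (s - 1) := key
    _ = ((L + s + 1).choose (s - 1) : ℝ) * (Real.log 2 ^ (s - 1) * (s - 1).factorial) := by ring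

/-- **Roth's inequality, logarithmic form**:
`∫_{[0,1]^s} (N Δ_P(z))² dz ≥ (log N)^{s−1} / ((log 2)^{s−1} (s−1)! 2^{4s+8})`.
[cite: DickPillichshammer2010, proof of Thm. 3.20 (last display)] -/
theorem roth_sq_lower_bound_log (hs : 1 ≤ s) (hN : 0 < N) :
    Real.log N ^ (s - 1) / (2 ^ (4 * s + 8) * Real.log 2 ^ (s - 1) * (s - 1).factorial) ≤
      (N : ℝ) ^ 2 * l2DiscrepancySq x := by
  refine le_trans ?_ (roth_sq_lower_bound_choose x hs hN)
  have h := log_pow_le_choose hs hN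
  have e : Real.log N ^ (s - 1) / (2 ^ (4 * s + 8) * Real.log 2 ^ (s - 1) * (s - 1).factorial) =
      Real.log N ^ (s - 1) / (Real.log 2 ^ (s - 1) * (s - 1).factorial) / 2 ^ (4 * s + 8) := by
    rw [div_div]; congr 1; ring
  rw [e]
  exact div_le_div_of_nonneg_right h (by positivity)


/-! ### Roth's constant and the logarithmic form -/

/-- Roth's constant `c_s = 1 / (2^{2s+4} (log 2)^{(s−1)/2} √((s−1)!))`.
[cite: DickPillichshammer2010, Thm. 3.20] -/
def rothConstant (s : ℕ) : ℝ :=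
  1 / (2 ^ (2 * s + 4) * Real.log 2 ^ (((s : ℝ) - 1) / 2) * Real.sqrt ((s - 1).factorial))

/-- `c_s > 0`. [cite: DickPillichshammer2010, Thm. 3.20 (the constant `c_s`)] -/
theorem rothConstant_pos (s : ℕ) : 0 < rothConstant s := by
  unfold rothConstant
  have hlog2 : 0 < Real.log 2 := Real.log_pos one_lt_two
  have hf : (0 : ℝ) < (s - 1).factorial := by exact_mod_cast Nat.factorial_pos _
  have h1 : 0 < Real.log 2 ^ (((s : ℝ) - 1) / 2) := Real.rpow_pos_of_pos hlog2 _
  have h2 : 0 < Real.sqrt ((s - 1).factorial) := Real.sqrt_pos.2 hf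
  positivity

/-- `(y^{(s−1)/2})² = y^{s−1}` for `y ≥ 0`, `s ≥ 1`. [folklore] -/
private theorem rpow_half_sq {y : ℝ} (hy : 0 ≤ y) (hs : 1 ≤ s) :
    (y ^ (((s : ℝ) - 1) / 2)) ^ 2 = y ^ (s - 1) := by
  rw [← Real.rpow_natCast (y ^ (((s : ℝ) - 1) / 2)) 2, ← Real.rpow_mul hy]
  have e : ((s : ℝ) - 1) / 2 * ((2 : ℕ) : ℝ) = ((s - 1 : ℕ) : ℝ) := by
    push_cast [Nat.cast_sub hs]; ring
  rw [e, Real.rpow_natCast]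

/-- `c_s² = 1 / (2^{4s+8} (log 2)^{s−1} (s−1)!)` (the constant of the last display of the proof).
[cite: DickPillichshammer2010, Thm. 3.20 and proof (last display)] -/
theorem rothConstant_sq (hs : 1 ≤ s) :
    rothConstant s ^ 2 = 1 / (2 ^ (4 * s + 8) * Real.log 2 ^ (s - 1) * (s - 1).factorial) := by
  unfold rothConstant
  have hlog2 : 0 < Real.log 2 := Real.log_pos one_lt_two
  have e1 : (Real.log 2 ^ (((s : ℝ) - 1) / 2)) ^ 2 = Real.log 2 ^ (s - 1) := rpow_half_sq hlog2.le hs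
  have e2 : Real.sqrt ((s - 1).factorial) ^ 2 = ((s - 1).factorial : ℝ) :=
    Real.sq_sqrt (Nat.cast_nonneg _)
  have e3 : ((2 : ℝ) ^ (2 * s + 4)) ^ 2 = 2 ^ (4 * s + 8) := by
    rw [← pow_mul]; congr 1; ring
  rw [div_pow, one_pow, mul_pow, mul_pow, e1, e2, e3]

/-- **Roth's lower bound on the `L₂`-discrepancy** (Theorem 3.20, second printed inequality):
`L_{2,N}(P) ≥ c_s (log N)^{(s−1)/2} / N` for every `N`-point set in the `s`-dimensional unit cube
(`s ≥ 1`, `N ≥ 1`), `c_s = Discrepancy.rothConstant s`.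
[cite: DickPillichshammer2010, Thm. 3.20; Roth1954; KuipersNiederreiter1974, Ch. 2 Thm. 2.1] -/
theorem roth_lower_bound (hs : 1 ≤ s) (hN : 0 < N) :
    rothConstant s * Real.log N ^ (((s : ℝ) - 1) / 2) / N ≤ Real.sqrt (l2DiscrepancySq x) := by
  have hN0 : (0 : ℝ) < N := by exact_mod_cast hN
  have hlogN : 0 ≤ Real.log N := Real.log_nonneg (by exact_mod_cast hN)
  refine Real.le_sqrt_of_sq_le ?_
  rw [div_pow, mul_pow, rothConstant_sq hs, rpow_half_sq hlogN hs, div_le_iff₀ (by positivity)]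
  have h := roth_sq_lower_bound_log x hs hN
  calc 1 / (2 ^ (4 * s + 8) * Real.log 2 ^ (s - 1) * ((s - 1).factorial : ℝ)) * Real.log N ^ (s - 1)
      = Real.log N ^ (s - 1) / (2 ^ (4 * s + 8) * Real.log 2 ^ (s - 1) * ((s - 1).factorial : ℝ)) := by
        ring
    _ ≤ (N : ℝ) ^ 2 * l2DiscrepancySq x := h
    _ = l2DiscrepancySq x * (N : ℝ) ^ 2 := mul_comm _ _

/-! ### Remark 3.21: the same bounds for the star discrepancy -/

/-- `L_{2,N}(P)² ≤ D*_N(P)²`: the `L₂` norm of `Δ_P` on the unit cube is at most its sup norm.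
[cite: DickPillichshammer2010, Rem. 3.21 and the remark after Def. 3.19 ("`L_{q,N}(P) ≤ D*_N(P)`")] -/
theorem l2DiscrepancySq_le_starDiscrepancy_sq : l2DiscrepancySq x ≤ starDiscrepancy x ^ 2 := by
  unfold l2DiscrepancySq
  have hint : IntegrableOn (fun z => boxDelta x z ^ 2) (Icc (0 : Fin s → ℝ) 1) :=
    integrableOn_cube_of_bounded₀ ((measurable_boxDelta₀ x).pow_const 2) 1 fun z hz => by
      rw [abs_pow]
      exact pow_le_one₀ (abs_nonneg _)
        ((abs_boxDelta_le_starDiscrepancy x hz).trans (starDiscrepancy_le_one x))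
  have hvol : (volume : Measure (Fin s → ℝ)).real (Icc 0 1) = 1 := by
    rw [measureReal_def, Real.volume_Icc_pi]
    simp
  calc ∫ z in Icc (0 : Fin s → ℝ) 1, boxDelta x z ^ 2
      ≤ ∫ z in Icc (0 : Fin s → ℝ) 1, starDiscrepancy x ^ 2 :=
        setIntegral_mono_on hint (continuousOn_const.integrableOn_compact isCompact_Icc)
          measurableSet_Icc fun z hz => by
            rw [← sq_abs]
            exact pow_le_pow_left₀ (abs_nonneg _) (abs_boxDelta_le_starDiscrepancy x hz) 2
    _ = starDiscrepancy x ^ 2 := by rw [setIntegral_const, hvol, one_smul]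

/-- `L_{2,N}(P) ≤ D*_N(P)`. [cite: DickPillichshammer2010, Rem. 3.21] -/
theorem sqrt_l2DiscrepancySq_le_starDiscrepancy :
    Real.sqrt (l2DiscrepancySq x) ≤ starDiscrepancy x :=
  (Real.sqrt_le_sqrt (l2DiscrepancySq_le_starDiscrepancy_sq x)).trans_eq
    (Real.sqrt_sq (starDiscrepancy_nonneg x))

/-- **Roth's lower bound for the star discrepancy** (binomial form):
`D*_N(P) ≥ (1/N) √(binom(⌊log₂ N⌋ + s + 1, s − 1)) · 2^{−(2s+4)}`.
[cite: DickPillichshammer2010, Thm. 3.20 with Rem. 3.21] -/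
theorem roth_lower_bound_starDiscrepancy_choose (hs : 1 ≤ s) (hN : 0 < N) :
    1 / (N : ℝ) * Real.sqrt ((Nat.log 2 N + s + 1).choose (s - 1)) * (1 / 2 ^ (2 * s + 4)) ≤
      starDiscrepancy x :=
  (roth_lower_bound_choose x hs hN).trans (sqrt_l2DiscrepancySq_le_starDiscrepancy x)

/-- **Roth's lower bound for the star discrepancy**: `N · D*_N(P) ≥ c_s (log N)^{(s−1)/2}` for
every `N`-point set in the `s`-dimensional unit cube (`s ≥ 1`, `N ≥ 1`) — in dimension `s ≥ 2`
the star discrepancy cannot be `O(1/N)`.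
[cite: DickPillichshammer2010, Thm. 3.20 with Rem. 3.21; Roth1954] -/
theorem roth_lower_bound_starDiscrepancy (hs : 1 ≤ s) (hN : 0 < N) :
    rothConstant s * Real.log N ^ (((s : ℝ) - 1) / 2) ≤ N * starDiscrepancy x := by
  have hN0 : (0 : ℝ) < N := by exact_mod_cast hN
  have h := (roth_lower_bound x hs hN).trans (sqrt_l2DiscrepancySq_le_starDiscrepancy x)
  rw [div_le_iff₀ hN0] at h
  exact h.trans_eq (mul_comm _ _)

end Roth

end Discrepancy

end Literature.NumberTheory.DiophantineApproximation
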